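import Literature.Topology.FourManifolds.GompfTubeMoves
import Literature.Topology.FourManifolds.GompfTheorem43
import Mathlib.Analysis.Matrix.Normed
import Mathlib.Analysis.SpecialFunctions.SmoothTransition
import Mathlib.Analysis.SpecificLimits.Normed
import Mathlib.Analysis.Calculus.ContDiff.Operations
import Mathlib.Analysis.Normed.Ring.Units
import HarnessLib

/-!
# W — `X^σ_A` depends only on the straightening class (Gompf 2010, Def. 4.1, §4 ¶2)

This file discharges the named fact `Literature.Topology.FourManifolds.gompf2010_straightening_invariance` (**W**):
for smooth matrix paths `γ, γ' : 1 ⟿ A` in `GL⁺(3, ℝ)` with `[γ] = [γ']` (homotopic as paths),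
`gompfSphere A γ ≃ₘ gompfSphere A γ'` (`Literature.Topology.FourManifolds.gompf2010_straightening_invariance_holds`).

## Proof

`GompfTubeMoves` proves the local step: uniformly close straightenings (`Literature.Topology.FourManifolds.TubeClose`, the
fibre transition operators `γ(θ)⁻¹ γ'(θ)` within a fixed threshold of `1`) give diffeomorphic
spheres. Here we chain it along a homotopy `H : γ ≃ γ'`:

* **smoothing** (`Literature.Topology.FourManifolds.plSmooth`, `Literature.Topology.FourManifolds.plPath`): a continuous path `q` (constant off `[0, 1]`) is
  uniformly approximated by the *smoothed piecewise-linear interpolation*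
  `θ ↦ q(0) + Σ_{k<m} σ(mθ - k) (q((k+1)/m) - q(k/m))` (`σ` = `Real.smoothTransition`), which is
  smooth, has the exact plateaus `q(0)` on `θ ≤ 0` and `q(1)` on `θ ≥ 1`, and on `[k/m, (k+1)/m]`
  is a convex combination of `q(k/m), q((k+1)/m)` (`Literature.Topology.FourManifolds.norm_plSmooth_sub_le`);
* **inverses** (`Literature.Topology.FourManifolds.isUnit_of_norm_sub_le`, Neumann series in the Banach algebra of `3 × 3`
  matrices with the `ℓ∞`-operator norm): matrices within `1/(2K₀)` of the compact family `H(I²)`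
  (whose inverses are bounded by `K₀`) are invertible with inverse bounded by `2K₀`; this makes the
  smoothed paths `SmoothMatrixPath`s (`Literature.ChainData.smoothedPath`) and feeds
* **the closeness criterion** `Literature.Topology.FourManifolds.tubeClose_of_norm_le`
  (`‖γ⁻¹ γ' - 1‖ ≤ ‖γ⁻¹‖ ‖γ' - γ‖`, and `‖·‖_{op, ℓ²} ≤ 9 ‖·‖_{op, ℓ∞}`);
* **the chain** (`Literature.ChainData`): by uniform continuity of `H` on `I²`, for fine enough meshes
  `1/m, 1/n` the smoothed paths `S_{i/n}` of `H(i/n, ·)` are consecutively close, `S_0` is close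
  to `γ` and `S_1` to `γ'`; compose the diffeomorphisms.

## References
* R. E. Gompf, *More Cappell–Shaneson spheres are standard*, AGT 10 (2010), Def. 4.1, §4 ¶2.
* R. E. Gompf, A. I. Stipsicz, *4-Manifolds and Kirby Calculus*, GSM 20 (1999), §5.2.
-/

noncomputable section

open scoped Manifold ContDiff Topology unitInterval Matrix.Norms.Operator
open Set Function Metric Filter

namespace Literature.Topology.FourManifolds

/-- Local notation: `𝔼 n` is the model Euclidean space `EuclideanSpace ℝ (Fin n)`. -/
local notation "𝔼 " n:arg => EuclideanSpace ℝ (Fin n)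

/-- Local notation: `𝕄` is the algebra of real `3 × 3` matrices (with the `ℓ∞`-operator norm). -/
local notation "𝕄" => Matrix (Fin 3) (Fin 3) ℝ

/-! ### Smoothed piecewise-linear interpolation in a normed space -/

section PLSmooth

variable {F : Type*} [NormedAddCommGroup F] [NormedSpace ℝ F]

/-- **Smoothed piecewise-linear interpolation** of `q` at the nodes `k/m`:
`θ ↦ q(0) + Σ_{k<m} σ(mθ - k) • (q((k+1)/m) - q(k/m))`, `σ = Real.smoothTransition`. [folklore] -/
def plSmooth (q : ℝ → F) (m : ℕ) (θ : ℝ) : F :=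
  q 0 + ∑ k ∈ Finset.range m,
    Real.smoothTransition (m * θ - k) • (q (((k + 1 : ℕ) : ℝ) / m) - q ((k : ℝ) / m))

/-- For `θ ≤ 0` the interpolation is `q 0`. [folklore] -/
theorem plSmooth_of_le_zero (q : ℝ → F) (m : ℕ) {θ : ℝ} (hθ : θ ≤ 0) : plSmooth q m θ = q 0 := by
  unfold plSmooth
  rw [Finset.sum_eq_zero, add_zero]
  intro k _
  have h1 : (m : ℝ) * θ ≤ 0 := mul_nonpos_of_nonneg_of_nonpos (Nat.cast_nonneg m) hθ
  have h2 : (0 : ℝ) ≤ k := Nat.cast_nonneg k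
  rw [Real.smoothTransition.zero_of_nonpos (by linarith), zero_smul]

/-- For `θ ≥ 1` the interpolation is `q 1` (telescoping). [folklore] -/
theorem plSmooth_of_one_le (q : ℝ → F) {m : ℕ} (hm : 0 < m) {θ : ℝ} (hθ : 1 ≤ θ) :
    plSmooth q m θ = q 1 := by
  unfold plSmooth
  have hm' : (0 : ℝ) < m := Nat.cast_pos.2 hm
  have h : ∀ k ∈ Finset.range m, Real.smoothTransition (m * θ - k) •
      (q (((k + 1 : ℕ) : ℝ) / m) - q ((k : ℝ) / m)) = q (((k + 1 : ℕ) : ℝ) / m) - q ((k : ℝ) / m) := by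
    intro k hk
    have hk' : (k : ℝ) + 1 ≤ m := by exact_mod_cast Finset.mem_range.1 hk
    have h1 : (m : ℝ) ≤ m * θ := le_mul_of_one_le_right hm'.le hθ
    rw [Real.smoothTransition.one_of_one_le (by linarith), one_smul]
  rw [Finset.sum_congr rfl h, Finset.sum_range_sub (fun k : ℕ ↦ q ((k : ℝ) / m)) m]
  simp [div_self hm'.ne']

/-- The interpolation is smooth (whatever `q` is). [folklore] -/
theorem contDiff_plSmooth (q : ℝ → F) (m : ℕ) : ContDiff ℝ ∞ (plSmooth q m) := by
  unfold plSmooth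
  refine contDiff_const.add (ContDiff.sum fun k _ ↦ ?_)
  exact (Real.smoothTransition.contDiff.comp
    ((contDiff_const.mul contDiff_id).sub contDiff_const)).smul contDiff_const

/-- **Uniform approximation**: if `‖q θ₁ - q θ₂‖ ≤ δ` whenever `θ₁, θ₂ ∈ [0, 1]`,
`|θ₁ - θ₂| ≤ 1/m`, then `‖plSmooth q m θ - q θ‖ ≤ δ` on `[0, 1]` (on `[k/m, (k+1)/m]` the
interpolation is a convex combination of `q(k/m)` and `q((k+1)/m)`). [folklore] -/
theorem norm_plSmooth_sub_le (q : ℝ → F) {m : ℕ} (hm : 0 < m) {δ : ℝ}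
    (hq : ∀ θ₁ ∈ Icc (0 : ℝ) 1, ∀ θ₂ ∈ Icc (0 : ℝ) 1, |θ₁ - θ₂| ≤ 1 / m → ‖q θ₁ - q θ₂‖ ≤ δ)
    {θ : ℝ} (hθ : θ ∈ Icc (0 : ℝ) 1) : ‖plSmooth q m θ - q θ‖ ≤ δ := by
  have hm' : (0 : ℝ) < m := Nat.cast_pos.2 hm
  have hmθ : 0 ≤ (m : ℝ) * θ := mul_nonneg hm'.le hθ.1
  -- the index `k₀` of the interval `[k₀/m, (k₀+1)/m] ∋ θ`
  obtain ⟨k₀, hk₀m, hk₀le, hk₀ge⟩ : ∃ k₀ : ℕ, k₀ < m ∧ (k₀ : ℝ) ≤ m * θ ∧ (m : ℝ) * θ ≤ k₀ + 1 := by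
    by_cases h : ⌊(m : ℝ) * θ⌋₊ < m
    · exact ⟨_, h, Nat.floor_le hmθ, (Nat.lt_floor_add_one _).le⟩
    · refine ⟨m - 1, Nat.sub_lt hm one_pos, ?_, ?_⟩
      · have h1 : ((m - 1 : ℕ) : ℝ) ≤ ⌊(m : ℝ) * θ⌋₊ := by
          exact_mod_cast (Nat.sub_le m 1).trans (not_lt.1 h)
        exact h1.trans (Nat.floor_le hmθ)
      · have h1 : ((m - 1 : ℕ) : ℝ) + 1 = m := by
          rw [Nat.cast_sub (Nat.one_le_iff_ne_zero.2 hm.ne'), Nat.cast_one, sub_add_cancel]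
        rw [h1]
        exact mul_le_of_le_one_right hm'.le hθ.2
  -- split the sum at `k₀`
  set f : ℕ → F := fun k ↦ Real.smoothTransition (m * θ - k) •
    (q (((k + 1 : ℕ) : ℝ) / m) - q ((k : ℝ) / m)) with hf
  have hsplit : ∑ k ∈ Finset.range m, f k =
      ∑ k ∈ Finset.range k₀, f k + (f k₀ + ∑ k ∈ Finset.Ico (k₀ + 1) m, f k) := by
    rw [Finset.range_eq_Ico, ← Finset.sum_Ico_consecutive f (Nat.zero_le k₀) hk₀m.le,
      Finset.sum_eq_sum_Ico_succ_bot hk₀m, Finset.range_eq_Ico]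
  have hlow : ∀ k ∈ Finset.range k₀, f k = q (((k + 1 : ℕ) : ℝ) / m) - q ((k : ℝ) / m) := by
    intro k hk
    have hk' : (k : ℝ) + 1 ≤ k₀ := by exact_mod_cast Finset.mem_range.1 hk
    rw [hf]
    dsimp only
    rw [Real.smoothTransition.one_of_one_le (by linarith), one_smul]
  have hhigh : ∀ k ∈ Finset.Ico (k₀ + 1) m, f k = 0 := by
    intro k hk
    have hk' : (k₀ : ℝ) + 1 ≤ k := by exact_mod_cast (Finset.mem_Ico.1 hk).1
    rw [hf]
    dsimp only
    rw [Real.smoothTransition.zero_of_nonpos (by linarith), zero_smul]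
  have htel : ∑ k ∈ Finset.range k₀, f k = q ((k₀ : ℝ) / m) - q 0 := by
    rw [Finset.sum_congr rfl hlow, Finset.sum_range_sub (fun k : ℕ ↦ q ((k : ℝ) / m)) k₀]
    simp
  set s := Real.smoothTransition (m * θ - k₀) with hs
  have hs0 : 0 ≤ s := Real.smoothTransition.nonneg _
  have hs1 : s ≤ 1 := Real.smoothTransition.le_one _
  have hval : plSmooth q m θ - q θ =
      (1 - s) • (q ((k₀ : ℝ) / m) - q θ) + s • (q (((k₀ + 1 : ℕ) : ℝ) / m) - q θ) := by
    unfold plSmooth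
    rw [hsplit, Finset.sum_eq_zero hhigh, add_zero, htel, hf]
    dsimp only
    rw [← hs]
    simp only [sub_smul, one_smul, smul_sub]
    abel
  rw [hval]
  -- the two nodes are within `1/m` of `θ`
  have hk₀I : (k₀ : ℝ) / m ∈ Icc (0 : ℝ) 1 :=
    ⟨by positivity, by rw [div_le_one hm']; exact_mod_cast hk₀m.le⟩
  have hk₁I : (((k₀ + 1 : ℕ) : ℝ)) / m ∈ Icc (0 : ℝ) 1 :=
    ⟨by positivity, by rw [div_le_one hm']; exact_mod_cast hk₀m⟩
  have hd₀ : |(k₀ : ℝ) / m - θ| ≤ 1 / m := by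
    rw [show (k₀ : ℝ) / m - θ = (k₀ - m * θ) / m by field_simp, abs_div, abs_of_pos hm',
      div_le_div_iff_of_pos_right hm', abs_le]
    constructor <;> linarith
  have hd₁ : |(((k₀ + 1 : ℕ) : ℝ)) / m - θ| ≤ 1 / m := by
    rw [show (((k₀ + 1 : ℕ) : ℝ)) / m - θ = (k₀ + 1 - m * θ) / m by push_cast; field_simp,
      abs_div, abs_of_pos hm', div_le_div_iff_of_pos_right hm', abs_le]
    constructor <;> linarith
  have h1 : ‖q ((k₀ : ℝ) / m) - q θ‖ ≤ δ := hq _ hk₀I _ hθ hd₀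
  have h2 : ‖q (((k₀ + 1 : ℕ) : ℝ) / m) - q θ‖ ≤ δ := hq _ hk₁I _ hθ hd₁
  calc ‖(1 - s) • (q ((k₀ : ℝ) / m) - q θ) + s • (q (((k₀ + 1 : ℕ) : ℝ) / m) - q θ)‖
      ≤ ‖(1 - s) • (q ((k₀ : ℝ) / m) - q θ)‖ + ‖s • (q (((k₀ + 1 : ℕ) : ℝ) / m) - q θ)‖ :=
        norm_add_le _ _
    _ = (1 - s) * ‖q ((k₀ : ℝ) / m) - q θ‖ + s * ‖q (((k₀ + 1 : ℕ) : ℝ) / m) - q θ‖ := by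
        rw [norm_smul, norm_smul, Real.norm_of_nonneg (by linarith), Real.norm_of_nonneg hs0]
    _ ≤ (1 - s) * δ + s * δ := by
        have hs' : 0 ≤ 1 - s := by linarith
        gcongr
    _ = δ := by ring

end PLSmooth

/-! ### Units in a Banach algebra: Neumann series -/

section Neumann

variable {R : Type*} [NormedRing R] [NormOneClass R] [CompleteSpace R]

/-- **Perturbation of units.** If `a` has a two-sided inverse `y` with `‖y‖ ≤ K` and
`‖b - a‖ ≤ δ` with `K δ ≤ 1/2`, then `b` is a unit and any left inverse `z` of `b` has
`‖z‖ ≤ 2K` (Neumann series: `b = a (1 + y (b - a))`). [folklore] -/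
theorem isUnit_of_norm_sub_le {a b y : R} {K δ : ℝ} (hya : y * a = 1) (hay : a * y = 1)
    (hy : ‖y‖ ≤ K) (hb : ‖b - a‖ ≤ δ) (hKδ : K * δ ≤ 1 / 2) :
    IsUnit b ∧ ∀ z, z * b = 1 → ‖z‖ ≤ 2 * K := by
  have hK : 0 ≤ K := (norm_nonneg _).trans hy
  set t := y * (b - a) with ht
  have htn : ‖t‖ ≤ 1 / 2 :=
    (norm_mul_le _ _).trans ((mul_le_mul hy hb (norm_nonneg _) hK).trans hKδ)
  have hb' : b = a * (1 + t) := by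
    rw [ht, mul_add, mul_one, ← mul_assoc, hay, one_mul, add_sub_cancel]
  have hu1 : IsUnit (1 + t) := by
    have h := (Units.oneSub (-t) (by rw [norm_neg]; linarith)).isUnit
    rwa [Units.val_oneSub, sub_neg_eq_add] at h
  have hua : IsUnit a := ⟨⟨a, y, hay, hya⟩, rfl⟩
  refine ⟨hb' ▸ hua.mul hu1, fun z hz ↦ ?_⟩
  have hc : z * a * (1 + t) = 1 := by rw [mul_assoc, ← hb', hz]
  have hc' : z * a = 1 - z * a * t := by
    rw [mul_add, mul_one] at hc
    exact eq_sub_of_add_eq hc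
  have hn : ‖z * a‖ ≤ 2 := by
    have h1 : ‖z * a‖ ≤ 1 + ‖z * a‖ * (1 / 2) :=
      calc ‖z * a‖ = ‖1 - z * a * t‖ := by rw [← hc']
        _ ≤ ‖(1 : R)‖ + ‖z * a * t‖ := norm_sub_le _ _
        _ ≤ 1 + ‖z * a‖ * ‖t‖ := by rw [norm_one]; exact add_le_add le_rfl (norm_mul_le _ _)
        _ ≤ 1 + ‖z * a‖ * (1 / 2) := by gcongr
    linarith
  calc ‖z‖ = ‖z * a * y‖ := by rw [mul_assoc, hay, mul_one]
    _ ≤ ‖z * a‖ * ‖y‖ := norm_mul_le _ _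
    _ ≤ 2 * K := mul_le_mul hn hy (norm_nonneg _) zero_le_two

end Neumann

/-! ### `3 × 3` matrices with the `ℓ∞`-operator norm -/

section MatrixNorm

/-- Entries are bounded by the `ℓ∞`-operator norm. [folklore] -/
theorem abs_entry_le_norm (N : 𝕄) (i j : Fin 3) : |N i j| ≤ ‖N‖ := by
  rw [Matrix.linfty_opNorm_def]
  have h1 : ‖N i j‖₊ ≤ ∑ j, ‖N i j‖₊ :=
    Finset.single_le_sum (f := fun j ↦ ‖N i j‖₊) (fun _ _ ↦ bot_le) (Finset.mem_univ j)
  have h2 : (∑ j, ‖N i j‖₊) ≤ Finset.univ.sup fun i ↦ ∑ j, ‖N i j‖₊ :=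
    Finset.le_sup (f := fun i ↦ ∑ j, ‖N i j‖₊) (Finset.mem_univ i)
  have := h1.trans h2
  rw [← Real.norm_eq_abs, ← coe_nnnorm]
  exact_mod_cast this

/-- The Euclidean norm on `𝔼 3` is bounded by the sum of the coordinates' absolute values.
[folklore] -/
theorem norm_le_sum_abs (x : 𝔼 3) : ‖x‖ ≤ ∑ i, |x i| := by
  rw [EuclideanSpace.norm_eq]
  have h : ∑ i, ‖x i‖ ^ 2 ≤ (∑ i, |x i|) ^ 2 := by
    rw [sq, Finset.sum_mul_sum]
    refine Finset.sum_le_sum fun i _ ↦ ?_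
    rw [Real.norm_eq_abs, sq]
    exact Finset.single_le_sum (f := fun j ↦ |x i| * |x j|)
      (fun j _ ↦ mul_nonneg (abs_nonneg _) (abs_nonneg _)) (Finset.mem_univ i)
  calc √(∑ i, ‖x i‖ ^ 2) ≤ √((∑ i, |x i|) ^ 2) := Real.sqrt_le_sqrt h
    _ = ∑ i, |x i| := Real.sqrt_sq (Finset.sum_nonneg fun i _ ↦ abs_nonneg _)

/-- **Comparison of operator norms**: `‖matCLM N‖ ≤ 9 ‖N‖_{ℓ∞-op}`. [folklore] -/
theorem norm_matCLM_le (N : 𝕄) : ‖matCLM N‖ ≤ 9 * ‖N‖ := by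
  refine ContinuousLinearMap.opNorm_le_bound _ (by positivity) fun v ↦ ?_
  rw [matCLM_apply]
  calc ‖mulVecE N v‖ ≤ ∑ i, |mulVecE N v i| := norm_le_sum_abs _
    _ ≤ ∑ _i : Fin 3, 3 * ‖N‖ * ‖v‖ := Finset.sum_le_sum fun i _ ↦ by
        have := abs_mulVecE_apply_le (m := 3) (fun i j ↦ abs_entry_le_norm N i j) v i
        exact_mod_cast this
    _ = 9 * ‖N‖ * ‖v‖ := by simp only [Finset.sum_const, Finset.card_univ, Fintype.card_fin,
        nsmul_eq_mul, Nat.cast_ofNat]; ring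

/-- Extracting an entry is a continuous linear functional (finite dimension). [folklore] -/
def entryCLM (i j : Fin 3) : 𝕄 →L[ℝ] ℝ :=
  LinearMap.toContinuousLinearMap (Matrix.entryLinearMap ℝ ℝ i j)

/-- `entryCLM i j N = N i j`. [folklore] -/
@[simp] theorem entryCLM_apply (i j : Fin 3) (N : 𝕄) : entryCLM i j N = N i j := rfl

/-- Entries of a smooth matrix-valued map are smooth. [folklore] -/
theorem contDiff_entry {S : ℝ → 𝕄} (hS : ContDiff ℝ ∞ S) (i j : Fin 3) :
    ContDiff ℝ ∞ fun θ ↦ S θ i j :=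
  (entryCLM i j).contDiff.comp hS

/-- A positive-determinant matrix as a unit of `𝕄`. [folklore] -/
def PosDetMatrix.unit (P : PosDetMatrix 3) : 𝕄ˣ :=
  ((Matrix.isUnit_iff_isUnit_det _).2 (isUnit_iff_ne_zero.2 P.2.ne')).unit

/-- The unit of a positive-determinant matrix is the matrix. [folklore] -/
@[simp] theorem PosDetMatrix.coe_unit (P : PosDetMatrix 3) : (PosDetMatrix.unit P : 𝕄) = P.1 :=
  IsUnit.unit_spec _

/-- A positive-determinant matrix is a unit. [folklore] -/
theorem PosDetMatrix.isUnit (P : PosDetMatrix 3) : IsUnit (P.1 : 𝕄) :=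
  (Matrix.isUnit_iff_isUnit_det _).2 (isUnit_iff_ne_zero.2 P.2.ne')

end MatrixNorm

/-! ### The closeness criterion -/

section Criterion

variable {M₀ : 𝕄} {γ₁ γ₂ : SmoothMatrixPath M₀}

/-- The inverse path is the ring inverse of the path. [folklore] -/
theorem SmoothMatrixPath.ringInverse_toFun (γ : SmoothMatrixPath M₀) (θ : ℝ) :
    Ring.inverse (γ.toFun θ) = γ.inv θ :=
  Ring.inverse_unit ⟨γ.toFun θ, γ.inv θ, γ.mul_inv θ, γ.inv_mul θ⟩

/-- **Closeness criterion**: if `‖γ₁⁻¹‖ ≤ K` and `‖γ₂ - γ₁‖ ≤ δ` pointwise with `9Kδ` below the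
threshold, then `TubeClose γ₁ γ₂` (as `γ₁⁻¹ γ₂ - 1 = γ₁⁻¹ (γ₂ - γ₁)`). [folklore] -/
theorem tubeClose_of_norm_le {K δ : ℝ} (hK : ∀ θ, ‖γ₁.inv θ‖ ≤ K)
    (hδ : ∀ θ, ‖γ₂.toFun θ - γ₁.toFun θ‖ ≤ δ) (h : 9 * (K * δ) < fibreThreshold) :
    TubeClose γ₁ γ₂ := by
  intro θ
  have h1 : moveOp γ₁ γ₂ θ - 1 = matCLM (γ₁.inv θ * (γ₂.toFun θ - γ₁.toFun θ)) := by
    rw [moveOp, mul_sub, γ₁.inv_mul, matCLM_sub, matCLM_one]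
  rw [h1]
  calc ‖matCLM (γ₁.inv θ * (γ₂.toFun θ - γ₁.toFun θ))‖
      ≤ 9 * ‖γ₁.inv θ * (γ₂.toFun θ - γ₁.toFun θ)‖ := norm_matCLM_le _
    _ ≤ 9 * (K * δ) := by
        gcongr
        exact (norm_mul_le _ _).trans
          (mul_le_mul (hK θ) (hδ θ) (norm_nonneg _) ((norm_nonneg _).trans (hK θ)))
    _ < fibreThreshold := h

end Criterion

/-! ### Smoothed paths as `SmoothMatrixPath`s -/

section PLPath

variable {M₀ : 𝕄}

/-- **The smoothed interpolation as a smooth matrix path** (when all its values are units; the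
inverse path is the ring inverse, smooth by `contDiffAt_ringInverse`). [folklore] -/
def plPath (q : ℝ → 𝕄) {m : ℕ} (hm : 0 < m) (h0 : q 0 = 1) (h1 : q 1 = M₀)
    (hU : ∀ θ, IsUnit (plSmooth q m θ)) : SmoothMatrixPath M₀ where
  toFun := plSmooth q m
  inv θ := Ring.inverse (plSmooth q m θ)
  contDiff_apply := contDiff_entry (contDiff_plSmooth q m)
  contDiff_inv_apply := by
    refine contDiff_entry (contDiff_iff_contDiffAt.2 fun θ ↦ ?_)
    have h := contDiffAt_ringInverse ℝ (n := ∞) (hU θ).unit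
    rw [IsUnit.unit_spec] at h
    exact h.comp θ (contDiff_plSmooth q m).contDiffAt
  mul_inv θ := Ring.mul_inverse_cancel _ (hU θ)
  inv_mul θ := Ring.inverse_mul_cancel _ (hU θ)
  eq_one θ hθ := by rw [plSmooth_of_le_zero q m hθ, h0]
  eq_self θ hθ := by rw [plSmooth_of_one_le q hm hθ, h1]

/-- Values of the smoothed path. [folklore] -/
@[simp] theorem plPath_toFun (q : ℝ → 𝕄) {m : ℕ} (hm : 0 < m) (h0 : q 0 = 1) (h1 : q 1 = M₀)
    (hU : ∀ θ, IsUnit (plSmooth q m θ)) : (plPath q hm h0 h1 hU).toFun = plSmooth q m := rfl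

/-- Inverse values of the smoothed path. [folklore] -/
@[simp] theorem plPath_inv (q : ℝ → 𝕄) {m : ℕ} (hm : 0 < m) (h0 : q 0 = 1) (h1 : q 1 = M₀)
    (hU : ∀ θ, IsUnit (plSmooth q m θ)) (θ : ℝ) :
    (plPath q hm h0 h1 hU).inv θ = Ring.inverse (plSmooth q m θ) := rfl

end PLPath

/-! ### Paths of a homotopy, extended to `ℝ` -/

namespace Straightening

section HomotopyPaths

variable {X₁ : PosDetMatrix 3} {p₀ p₁ : Path (1 : PosDetMatrix 3) X₁} (H : Path.Homotopy p₀ p₁)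

/-- The path of the homotopy at time `t`, extended to `ℝ` by its end values, as a matrix-valued
map. [folklore] -/
def hval (t : I) (θ : ℝ) : 𝕄 := ((H.eval t).extend θ).1

/-- `hval H t θ = H (t, projIcc θ)`. [folklore] -/
theorem hval_eq (t : I) (θ : ℝ) : hval H t θ = (H (t, projIcc 0 1 zero_le_one θ)).1 := by
  unfold hval
  rcases le_total θ 0 with h | h
  · rw [Path.extend_of_le_zero _ h, projIcc_of_le_left _ h]
    exact congrArg Subtype.val (H.eval t).source.symm
  · rcases le_total 1 θ with h1 | h1
    · rw [Path.extend_of_one_le _ h1, projIcc_of_right_le _ h1]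
      exact congrArg Subtype.val (H.eval t).target.symm
    · rw [Path.extend_apply _ ⟨h, h1⟩, projIcc_of_mem _ ⟨h, h1⟩]
      rfl

/-- For `θ ≤ 0`, `hval H t θ = 1`. [folklore] -/
theorem hval_of_le_zero (t : I) {θ : ℝ} (hθ : θ ≤ 0) : hval H t θ = 1 := by
  unfold hval
  rw [Path.extend_of_le_zero _ hθ]
  rfl

/-- For `θ ≥ 1`, `hval H t θ = X₁`. [folklore] -/
theorem hval_of_one_le (t : I) {θ : ℝ} (hθ : 1 ≤ θ) : hval H t θ = X₁.1 := by
  unfold hval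
  rw [Path.extend_of_one_le _ hθ]

/-- `hval H t 0 = 1`. [folklore] -/
theorem hval_zero (t : I) : hval H t 0 = 1 := hval_of_le_zero H t le_rfl

/-- `hval H t 1 = X₁`. [folklore] -/
theorem hval_one (t : I) : hval H t 1 = X₁.1 := hval_of_one_le H t le_rfl

/-- The extended path of a smooth matrix path is the path itself. [folklore] -/
theorem SmoothMatrixPath.toPath_extend {M₀ : 𝕄} (γ : SmoothMatrixPath M₀) (θ : ℝ) :
    (γ.toPath.extend θ).1 = γ.toFun θ := by
  rcases le_total θ 0 with h | h
  · rw [Path.extend_of_le_zero _ h, γ.eq_one θ h]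
    rfl
  · rcases le_total 1 θ with h1 | h1
    · rw [Path.extend_of_one_le _ h1, γ.eq_self θ h1]
    · rw [Path.extend_apply _ ⟨h, h1⟩]
      rfl

/-- **The inverses along a homotopy are uniformly bounded** (continuity of `Ring.inverse` on
units, compactness of `I × I`). [folklore] -/
theorem exists_norm_inverse_le :
    ∃ K₀ : ℝ, 0 ≤ K₀ ∧ ∀ p : I × I, ‖Ring.inverse (H p).1‖ ≤ K₀ := by
  have hc : Continuous fun p : I × I ↦ (H p).1 := H.continuous.subtype_val
  have hg : Continuous fun p : I × I ↦ Ring.inverse (H p).1 := by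
    refine continuous_iff_continuousAt.2 fun p ↦ ?_
    have h := NormedRing.inverse_continuousAt (PosDetMatrix.unit (H p))
    rw [PosDetMatrix.coe_unit] at h
    exact h.comp_of_eq hc.continuousAt rfl
  obtain ⟨p₀, -, hp₀⟩ := isCompact_univ.exists_isMaxOn univ_nonempty hg.norm.continuousOn
  exact ⟨_, norm_nonneg _, fun p ↦ hp₀ (mem_univ p)⟩

/-- **Uniform continuity of the homotopy** on the compact square. [folklore] -/
theorem exists_modulus {ε : ℝ} (hε : 0 < ε) :
    ∃ η > 0, ∀ p p' : I × I, dist p p' < η → ‖(H p).1 - (H p').1‖ < ε := by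
  have hu : UniformContinuous fun p : I × I ↦ (H p).1 :=
    CompactSpace.uniformContinuous_of_continuous H.continuous.subtype_val
  obtain ⟨η, hη, h⟩ := Metric.uniformContinuous_iff.1 hu ε hε
  exact ⟨η, hη, fun p p' hp ↦ by rw [← dist_eq_norm]; exact h hp⟩

end HomotopyPaths

/-! ### The chain data -/

section Chain

variable {X₁ : PosDetMatrix 3} {p₀ p₁ : Path (1 : PosDetMatrix 3) X₁}

/-- **The constants of the chain**: the inverse bound `K₀` along the homotopy, the accuracy `ε₀`
(small against `K₀` and the threshold), the uniform-continuity modulus `η` of `H` for `ε₀`, and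
meshes `1/m, 1/n < η`. [folklore] -/
structure ChainData (H : Path.Homotopy p₀ p₁) where
  /-- Bound on the inverses `‖H(p)⁻¹‖`. -/
  K₀ : ℝ
  /-- Accuracy. -/
  ε₀ : ℝ
  /-- Uniform-continuity modulus of `H` for `ε₀`. -/
  η : ℝ
  /-- Smoothing mesh. -/
  m : ℕ
  /-- Chain mesh. -/
  n : ℕ
  K₀_nonneg : 0 ≤ K₀
  inv_le : ∀ p : I × I, ‖Ring.inverse (H p).1‖ ≤ K₀
  ε₀_pos : 0 < ε₀
  Kε_le : K₀ * ε₀ ≤ 1 / 2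
  lt_threshold : 9 * (2 * K₀ * (3 * ε₀)) < fibreThreshold
  η_pos : 0 < η
  modulus : ∀ p p' : I × I, dist p p' < η → ‖(H p).1 - (H p').1‖ < ε₀
  m_pos : 0 < m
  m_lt : 1 / (m : ℝ) < η
  n_pos : 0 < n
  n_lt : 1 / (n : ℝ) < η

variable (H : Path.Homotopy p₀ p₁)

/-- **Chain data exist.** [folklore] -/
theorem nonempty_chainData : Nonempty (ChainData H) := by
  obtain ⟨K₀, hK₀, hinv⟩ := exists_norm_inverse_le H
  have hthr := fibreThreshold_pos
  set ε₀ : ℝ := min (fibreThreshold / (54 * K₀ + 54)) (1 / (2 * K₀ + 2)) with hε₀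
  have hε₀pos : 0 < ε₀ := lt_min (div_pos hthr (by positivity)) (div_pos one_pos (by positivity))
  have h1 : K₀ * ε₀ ≤ 1 / 2 := by
    have : ε₀ ≤ 1 / (2 * K₀ + 2) := min_le_right _ _
    calc K₀ * ε₀ ≤ K₀ * (1 / (2 * K₀ + 2)) := by gcongr
      _ ≤ 1 / 2 := by rw [mul_one_div, div_le_iff₀ (by positivity)]; linarith
  have h2 : 9 * (2 * K₀ * (3 * ε₀)) < fibreThreshold := by
    have : ε₀ ≤ fibreThreshold / (54 * K₀ + 54) := min_le_left _ _
    calc 9 * (2 * K₀ * (3 * ε₀)) = 54 * K₀ * ε₀ := by ring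
      _ ≤ 54 * K₀ * (fibreThreshold / (54 * K₀ + 54)) := by gcongr
      _ < fibreThreshold := by
          rw [mul_div_assoc', div_lt_iff₀ (by positivity)]
          nlinarith
  obtain ⟨η, hη, hmod⟩ := exists_modulus H hε₀pos
  obtain ⟨m, hm⟩ := exists_nat_one_div_lt hη
  obtain ⟨n, hn⟩ := exists_nat_one_div_lt hη
  refine ⟨⟨K₀, ε₀, η, m + 1, n + 1, hK₀, hinv, hε₀pos, h1, h2, hη, hmod, Nat.succ_pos _, ?_,
    Nat.succ_pos _, ?_⟩⟩
  · exact_mod_cast hm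
  · exact_mod_cast hn

variable {H} (D : ChainData H)

namespace ChainData

/-- The values of the homotopy are units with inverse bounded by `K₀`: two-sided inverse data
for the Neumann lemma. [folklore] -/
theorem inverse_hval (t : I) (θ : ℝ) :
    Ring.inverse (hval H t θ) * hval H t θ = 1 ∧ hval H t θ * Ring.inverse (hval H t θ) = 1 ∧
      ‖Ring.inverse (hval H t θ)‖ ≤ D.K₀ := by
  rw [hval_eq]
  exact ⟨Ring.inverse_mul_cancel _ (PosDetMatrix.isUnit _),
    Ring.mul_inverse_cancel _ (PosDetMatrix.isUnit _), D.inv_le _⟩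

/-- **The smoothing is `ε₀`-accurate**: `‖plSmooth (hval H t) m θ - hval H t θ‖ ≤ ε₀` for all
`θ`. [folklore] -/
theorem norm_plSmooth_hval_sub_le (t : I) (θ : ℝ) :
    ‖plSmooth (hval H t) D.m θ - hval H t θ‖ ≤ D.ε₀ := by
  rcases le_total θ 0 with h | h
  · rw [plSmooth_of_le_zero _ _ h, hval_of_le_zero H t h, hval_zero, sub_self, norm_zero]
    exact D.ε₀_pos.le
  · rcases le_total 1 θ with h1 | h1
    · rw [plSmooth_of_one_le _ D.m_pos h1, hval_of_one_le H t h1, hval_one, sub_self, norm_zero]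
      exact D.ε₀_pos.le
    · refine norm_plSmooth_sub_le _ D.m_pos (fun θ₁ hθ₁ θ₂ hθ₂ hd ↦ ?_) ⟨h, h1⟩
      rw [hval_eq, hval_eq, projIcc_of_mem _ hθ₁, projIcc_of_mem _ hθ₂]
      refine (D.modulus _ _ ?_).le
      rw [Prod.dist_eq, dist_self, max_eq_right dist_nonneg]
      exact hd.trans_lt D.m_lt

/-- The smoothed values are units, with inverse bounded by `2K₀`. [folklore] -/
theorem isUnit_plSmooth_hval (t : I) (θ : ℝ) :
    IsUnit (plSmooth (hval H t) D.m θ) ∧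
      ∀ z, z * plSmooth (hval H t) D.m θ = 1 → ‖z‖ ≤ 2 * D.K₀ := by
  obtain ⟨h1, h2, h3⟩ := D.inverse_hval t θ
  exact isUnit_of_norm_sub_le h1 h2 h3 (D.norm_plSmooth_hval_sub_le t θ) D.Kε_le

/-- **The smoothed path of the homotopy at time `t`.** [folklore] -/
def smoothedPath (t : I) : SmoothMatrixPath X₁.1 :=
  plPath (hval H t) D.m_pos (hval_zero H t) (hval_one H t) fun θ ↦ (D.isUnit_plSmooth_hval t θ).1

/-- The inverse of a smoothed path is bounded by `2K₀`. [folklore] -/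
theorem norm_inv_smoothedPath_le (t : I) (θ : ℝ) : ‖(D.smoothedPath t).inv θ‖ ≤ 2 * D.K₀ :=
  (D.isUnit_plSmooth_hval t θ).2 _ (Ring.inverse_mul_cancel _ (D.isUnit_plSmooth_hval t θ).1)

/-- Values of the homotopy at `η`-close times are `ε₀`-close (all `θ`). [folklore] -/
theorem norm_hval_sub_hval_le {t t' : I} (h : dist t t' < D.η) (θ : ℝ) :
    ‖hval H t θ - hval H t' θ‖ ≤ D.ε₀ := by
  rw [hval_eq, hval_eq]
  refine (D.modulus _ _ ?_).le
  rwa [Prod.dist_eq, dist_self, max_eq_left dist_nonneg]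

/-- **Consecutive smoothed paths are close**: for `dist t t' < η`,
`‖S_{t'} θ - S_t θ‖ ≤ 3 ε₀`. [folklore] -/
theorem norm_smoothedPath_sub_le {t t' : I} (h : dist t t' < D.η) (θ : ℝ) :
    ‖(D.smoothedPath t').toFun θ - (D.smoothedPath t).toFun θ‖ ≤ 3 * D.ε₀ := by
  simp only [smoothedPath, plPath_toFun]
  have h1 := D.norm_plSmooth_hval_sub_le t' θ
  have h2 := D.norm_hval_sub_hval_le h θ
  have h3 := D.norm_plSmooth_hval_sub_le t θ
  calc ‖plSmooth (hval H t') D.m θ - plSmooth (hval H t) D.m θ‖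
      = ‖(plSmooth (hval H t') D.m θ - hval H t' θ) - (hval H t θ - hval H t' θ) -
          (plSmooth (hval H t) D.m θ - hval H t θ)‖ := by congr 1; abel
    _ ≤ ‖(plSmooth (hval H t') D.m θ - hval H t' θ) - (hval H t θ - hval H t' θ)‖ +
          ‖plSmooth (hval H t) D.m θ - hval H t θ‖ := norm_sub_le _ _
    _ ≤ ‖plSmooth (hval H t') D.m θ - hval H t' θ‖ + ‖hval H t θ - hval H t' θ‖ +
          ‖plSmooth (hval H t) D.m θ - hval H t θ‖ := by
        gcongr
        exact norm_sub_le _ _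
    _ ≤ 3 * D.ε₀ := by linarith

/-- **Consecutive smoothed paths are tube-close.** [folklore] -/
theorem tubeClose_smoothedPath {t t' : I} (h : dist t t' < D.η) :
    TubeClose (D.smoothedPath t) (D.smoothedPath t') :=
  tubeClose_of_norm_le (D.norm_inv_smoothedPath_le t) (D.norm_smoothedPath_sub_le h)
    D.lt_threshold

end ChainData

end Chain

/-! ### The ends of the chain and the assembly -/

section Assembly

variable {A : Matrix.SpecialLinearGroup (Fin 3) ℤ} {γ γ' : SmoothMatrixPath (slRealMatrix A)}
  {H : Path.Homotopy γ.toPath γ'.toPath} (D : ChainData H)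

namespace ChainData

variable (H) in
/-- At time `0` the extended homotopy path is `γ` itself. [folklore] -/
theorem hval_zero_eq (θ : ℝ) : hval H 0 θ = γ.toFun θ := by
  rw [hval, Path.Homotopy.eval_zero, SmoothMatrixPath.toPath_extend]

variable (H) in
/-- At time `1` the extended homotopy path is `γ'`. [folklore] -/
theorem hval_one_eq (θ : ℝ) : hval H 1 θ = γ'.toFun θ := by
  rw [hval, Path.Homotopy.eval_one, SmoothMatrixPath.toPath_extend]

/-- **The first smoothed path is tube-close to `γ`** (both ways). [folklore] -/
theorem tubeClose_zero :
    TubeClose γ (D.smoothedPath 0) ∧ TubeClose (D.smoothedPath 0) γ := by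
  have hK : ∀ θ, ‖γ.inv θ‖ ≤ 2 * D.K₀ := fun θ ↦ by
    rw [← SmoothMatrixPath.ringInverse_toFun, ← hval_zero_eq H]
    exact (D.inverse_hval 0 θ).2.2.trans (by linarith [D.K₀_nonneg])
  have hδ : ∀ θ, ‖(D.smoothedPath 0).toFun θ - γ.toFun θ‖ ≤ 3 * D.ε₀ := fun θ ↦ by
    rw [← hval_zero_eq H θ]
    exact (D.norm_plSmooth_hval_sub_le 0 θ).trans (by linarith [D.ε₀_pos])
  have hδ' : ∀ θ, ‖γ.toFun θ - (D.smoothedPath 0).toFun θ‖ ≤ 3 * D.ε₀ := fun θ ↦ by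
    rw [norm_sub_rev]; exact hδ θ
  exact ⟨tubeClose_of_norm_le hK hδ D.lt_threshold,
    tubeClose_of_norm_le (D.norm_inv_smoothedPath_le 0) hδ' D.lt_threshold⟩

/-- **The last smoothed path is tube-close to `γ'`** (both ways). [folklore] -/
theorem tubeClose_one :
    TubeClose γ' (D.smoothedPath 1) ∧ TubeClose (D.smoothedPath 1) γ' := by
  have hK : ∀ θ, ‖γ'.inv θ‖ ≤ 2 * D.K₀ := fun θ ↦ by
    rw [← SmoothMatrixPath.ringInverse_toFun, ← hval_one_eq H]
    exact (D.inverse_hval 1 θ).2.2.trans (by linarith [D.K₀_nonneg])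
  have hδ : ∀ θ, ‖(D.smoothedPath 1).toFun θ - γ'.toFun θ‖ ≤ 3 * D.ε₀ := fun θ ↦ by
    rw [← hval_one_eq H θ]
    exact (D.norm_plSmooth_hval_sub_le 1 θ).trans (by linarith [D.ε₀_pos])
  have hδ' : ∀ θ, ‖γ'.toFun θ - (D.smoothedPath 1).toFun θ‖ ≤ 3 * D.ε₀ := fun θ ↦ by
    rw [norm_sub_rev]; exact hδ θ
  exact ⟨tubeClose_of_norm_le hK hδ D.lt_threshold,
    tubeClose_of_norm_le (D.norm_inv_smoothedPath_le 1) hδ' D.lt_threshold⟩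

/-- The chain times `t_i := projIcc (i/n)`. [folklore] -/
def node (i : ℕ) : I := projIcc 0 1 zero_le_one ((i : ℝ) / D.n)

/-- Consecutive nodes are `η`-close. [folklore] -/
theorem dist_node_lt (i : ℕ) : dist (D.node i) (D.node (i + 1)) < D.η := by
  have hn : (0 : ℝ) < D.n := Nat.cast_pos.2 D.n_pos
  rw [Subtype.dist_eq, Real.dist_eq, node, node]
  refine (abs_projIcc_sub_projIcc _).trans_lt ?_
  rw [show (i : ℝ) / D.n - ((i + 1 : ℕ) : ℝ) / D.n = -(1 / D.n) by push_cast; field_simp; ring,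
    abs_neg, abs_of_pos (by positivity)]
  exact D.n_lt

/-- `t_0 = 0`. [folklore] -/
theorem node_zero : D.node 0 = 0 := by
  rw [node, Nat.cast_zero, zero_div, projIcc_left]
  rfl

/-- `t_n = 1`. [folklore] -/
theorem node_n : D.node D.n = 1 := by
  rw [node, div_self (Nat.cast_pos.2 D.n_pos).ne', projIcc_right]
  rfl

variable (A) in
/-- **The chain of moves**: `gompfSphere A γ ≃ₘ gompfSphere A S_{t_i}` for all `i`. [folklore] -/
theorem nonempty_diffeomorph_node (i : ℕ) :
    Nonempty (gompfSphere A γ ≃ₘ⟮𝓡 4, 𝓡 4⟯ gompfSphere A (D.smoothedPath (D.node i))) := by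
  induction i with
  | zero =>
    rw [node_zero]
    exact nonempty_diffeomorph_gompfSphere_of_tubeClose A D.tubeClose_zero.1 D.tubeClose_zero.2
  | succ i ih =>
    obtain ⟨e₁⟩ := ih
    obtain ⟨e₂⟩ := nonempty_diffeomorph_gompfSphere_of_tubeClose A
      (D.tubeClose_smoothedPath (D.dist_node_lt i))
      (D.tubeClose_smoothedPath (by rw [dist_comm]; exact D.dist_node_lt i))
    exact ⟨e₁.trans e₂⟩

end ChainData

end Assembly

end Straightening

open Straightening in
/-- **W holds: `X^σ_A` depends only on the straightening class `σ = [γ]`.** For homotopic smooth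
matrix paths `γ ≃ γ'` (as paths `1 ⟿ A` in `GL⁺(3, ℝ)`), `gompfSphere A γ ≃ₘ gompfSphere A γ'`:
chain the local moves of `GompfTubeMoves` along the smoothed paths of a homotopy.
[cite: GompfAGT2010, Def. 4.1 and §4 ¶2] [cite: GompfStipsiczGSM1999, §5.2] -/
theorem gompf2010_straightening_invariance_holds : gompf2010_straightening_invariance := by
  intro A γ γ' hhom
  obtain ⟨H⟩ := hhom
  obtain ⟨D⟩ := nonempty_chainData H
  obtain ⟨e₁⟩ := D.nonempty_diffeomorph_node A D.n
  rw [D.node_n] at e₁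
  obtain ⟨e₂⟩ := nonempty_diffeomorph_gompfSphere_of_tubeClose A D.tubeClose_one.2 D.tubeClose_one.1
  exact ⟨e₁.trans e₂⟩

end Literature.Topology.FourManifolds
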